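import Literature.NumberTheory.EllipticCurves.Castella2018.PAdicWaldspurgerFormula
import Literature.NumberTheory.EllipticCurves.BertoliniDarmonPrasanna2013.DisplayWeightTwo
import HarnessLib

/-!
# Castella, JIMJ 17 (2018) [cas-split], Thm. 2.10 ∧ Thm. 2.11 at weight `2`, conductor `c = 1` —
# the BDP anticyclotomic `p`-adic `L`-function of a `p`-NEW newform (`p ≥ 5`, `p ‖ N`, `a_p(f)`
# symbolic, NO hypothesis on the residual image) is a CONTINUOUS function on BDP's character space
# `Σ̂_cc(𝔑)` with the interpolation display of Bertolini–Darmon–Prasanna 2013 ((5.2.3)–(5.2.4),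
# `L_alg` of Thm. 5.5 with the constants `C(f,χ,c)` of Thm. 4.6 and `w(f,χ)` of (5.1.11) VERBATIM),
# and its value at `𝐍_K` is `(1 − a_p p⁻¹)·log_{ω_E} P_K` up to a `p`-adic unit

Trunk T-NT-EC (`Literature/NumberTheory/EllipticCurves`), story `Castella2018Exceptional/` (F. Castella,
*On the exceptional specializations of big Heegner points*, J. Inst. Math. Jussieu 17 (2018) 207–240 =
arXiv:1507.04260; bib key `Castella2018Exceptional`). ONE named fact (`def … : Prop`, nothing asserted;
D-0014/D-0026 accounting: +1); no definition with a body — BDP 2013's printed constants and displays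
`C(f,χ,1)`, `w(f,χ)`, `L_alg`, `L_p(f,χ)` at `(k, c) = (2, 1)` are the definitions of the sister module
`BertoliniDarmonPrasanna2013/DisplayWeightTwo.lean` (`bdpConstC`, `bdpConstW`, `bdpLalg`, `bdpLp`). Cell `bsd-eis`, seat `bsd-eis-k5-c4` (HOME run/shared/lean/pub/bsd-eis/,
`k5-c4-MEMO-1.md` + Addenda v1.1/v1.2, LIT-DOSSIER §40/§40 (H)(H′)): consumer
`Summits/BirchSwinnertonDyer/Rank1Residual/X2/NonsplitBDPValueDisplayPNew.lean`, which PROVES from this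
fact — by an exact rescaling of BDP's display to Castella's display with virtual periods (BDP 2013
Rem. 5.6 / Rem. 5.8) and the X11b cell's avatar dictionary — the continuous-function display
`X2.NonsplitBDPValueContinuousDisplayAt W p` (`X2/NonsplitHalvesIntRigidity.lean`) at every non-split
X2 Heegner datum with `5 ≤ p`, and with it DISCHARGES the value half c2 of the non-split (b1) road of
crux 4 `BSDpOnCellC` (route `EisensteinPrimes`) at `p ≥ 5`. HONEST FRAMING: BSD is not proved by any
of this; X2 stays CONSTRUCTION-SHAPED; nothing below `p = 5`, nothing about `Λ_{R₀}`-membership.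

## The printed statements

### [cas-split] §2.5–2.6 (arXiv:1507.04260 pp. 13–14; held text `paper:arxiv-1507.04260`
### p0013–p0014, read by this seat 2026-08-26; before it bsd-eis-lit g3/g5, LIT-DOSSIER §1f/§2d(a)/§2e)

Standing data of §§0–2 (LIT-DOSSIER §2e(b), complete list): `p ≥ 5` (§1.4: `E_{p−1}`), an integer
`N > 0` prime to `p`, `f ∈ S_k(Γ₀(Np))` a `p`-new eigenform (`a_p(f)² = p^{k−2}`, EITHER sign — the
global «`a_p(f) = 1`» of the paper is used only in §3), `K` imaginary quadratic with a cyclic ideal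
`𝔑`, `𝒪_K/𝔑 ≅ ℤ/N` (classical Heegner hypothesis for the prime-to-`p` level `N`), `p = 𝔭𝔭̄` SPLIT in
`K`, `c ≥ 1` prime to `Np`; NO hypothesis on the residual image of `f`, NO square-freeness of `N`
(both first appear in §3, Assumptions 3.1). (p. 13) "Since we assume that `p = 𝔭𝔭̄` splits in `K`,
we may fix an isomorphism `μ_{p^∞} ≃ 𝒜₀[𝔭^∞]` … and we let `Ω_p ∈ ℂ_p^×` be the `p`-adic period
defined by the rule `ω₀ = Ω_p · ω_can`". "consider the set `Σ⁺_{k,c}` of algebraic Hecke characters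
`χ : K^×\𝔸_K^× → ℂ^×` of conductor `c`, infinity type `(k+j, −j)` with `j ≥ 0` (with the convention in
[bdp1]), and such that `χ|_{𝔸_ℚ^×} = 𝐍^k` … and define `L_alg(f,χ⁻¹) := w(f,χ)⁻¹C(f,χ,c)·
L(f,χ⁻¹,0)/Ω^{2(k+2j)}`, where `w(f,χ)` and `C(f,χ,c)` are the constants defined in [bdp1] and
[loc.cit., Thm. 4.6], respectively, `Ω` is the complex period in [loc.cit., (5.1.16)], and `L(f,χ⁻¹,0)`
is the central critical value of the Rankin–Selberg `L`-function `L(f × θ_{χ⁻¹}, s)` … As explained in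
[bdp1], the set `Σ⁺_{k,c}` may be endowed with a natural `p`-adic topology, and we let `Σ̂_{k,c}`
denote its completion." **Theorem 2.10.** "The assignment `χ ↦ L_𝔭(f)(χ)` extends to a continuous
function on `Σ̂_{k,c}` and satisfies the following interpolation property. If `χ ∈ Σ⁺_{k,c}` has
infinity type `(k+j, −j)`, with `j ≥ 0`, then `L_𝔭(f)(χ)²/Ω_p^{2(k+2j)} = (1 − a_p(f)χ⁻¹(𝔭̄))²·
L_alg(f,χ⁻¹,0)`. *Proof.* See Theorem 5.9, Proposition 5.10, and equation (5.2.4) of [bdp1], noting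
that `β_p = 0` here, since `f` has level divisible by `p`." (p. 13) "Let `Σ⁻_{k,c}` be the set of
algebraic Hecke characters of `K` of conductor `c` and infinity type `(k−1−j, 1+j)`, with `j ≥ 0`. …
any character in `Σ⁻_{k,c}` can be written as a limit of characters in `Σ⁺_{k,c}` (see [bdp1]). Thus
for any `χ ∈ Σ⁻_{k,c}`, the value `L_𝔭(f)(χ)` is defined by continuity." **Theorem 2.11** (p. 14).
"Let `f = q + ∑ a_n(f)qⁿ ∈ S_k(Γ₀(Np))` be a `p`-new eigenform of weight `k = r+2 ≥ 2`, and suppose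
that `χ ∈ Σ⁻_{k,c}` has infinity type `(r+1−j, 1+j)`, with `0 ≤ j ≤ r`. Then `L_𝔭(f)(χ)/Ω_p^{r−2j} =
(1 − a_p(f)χ⁻¹(𝔭̄))·((c^{−j}/j!)∑_{[𝔞] ∈ Pic(𝒪_c)} χ⁻¹(𝔞)N(𝔞)·AJ_F(Δ_{φ_𝔞φ₀})(ω_f ∧ ω_A^j η_A^{r−j}))`."
Its proof prints the identity "`χ(𝔭)p^{−1−j} = χ⁻¹(𝔭̄)p^{r+1−j}`" (i.e. `χ(𝔭)χ(𝔭̄) = p^k`). At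
`(k, r, j, c) = (2, 0, 0, 1)`, `χ = 𝐍_K` (infinity type `(1,1)`; `𝐍_K⁻¹(𝔞)N(𝔞) = 1`): `L_𝔭(f)(𝐍_K) =
(1 − a_p(f)p⁻¹)·AJ_F(∑_𝔞 Δ_𝔞)(ω_f)`, and Castella, Camb. J. Math. 6 (2018) p. 9 (proof of Thm. 3.2,
"[cas-split] in the case `p ∣ N`", displays (3.2)–(3.3), quoted in the sister file
`Castella2018/PAdicWaldspurgerFormula.lean`) converts `AJ_F(Δ)(ω_f) = log_{ω_f}(Δ)` [BK] and
`log_{ω_f} = log_{ω_E} ∘ π` up to the `p`-adic unit `c` of (3.2) `π^*ω_E = c·ω_f` into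
"`L_p(f, 𝟙) = (1 − a_p p⁻¹)²·(log_{ω_E} P_K)²` up to a `p`-adic unit", `P_K = ∑_σ π(Δ^σ) ∈ E(K)`.

### Bertolini–Darmon–Prasanna, Duke Math. J. 162 (2013) [bdp1] — the constants, VERBATIM (author
### version `paper:url-39cfb2a03b1d`, displays re-assembled at the glyph level by bsd-eis-lit g17,
### HOME/lit/src/bdp13-author/, LIT-DOSSIER §40 (A)–(F); author = journal numbering)

(p. 34) "a Hecke character of `K` of infinity type `(ℓ₁, ℓ₂)` … `χ(α·x·z_∞) = χ(x)·z_∞^{−ℓ₁} z̄_∞^{−ℓ₂}`",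
"(4.1.5) … As a function on ideals, `χ` satisfies `χ((α)) = α^{ℓ₁} ᾱ^{ℓ₂}` for all principal ideals
`(α)` with `α ≡ 1 mod 𝔣_χ`", "`L(f,χ,s) = L(π_f × π_χ, s − (k−1+ℓ₁+ℓ₂)/2)`", "Set `ℓ := |ℓ₁ − ℓ₂|`".
**Theorem 4.6** (p. 38): "Let `f` be a normalised eigenform in `S_k(Γ₀(N), ε_f)` and let
`χ ∈ Σ^{(2)}_cc(𝔑)` be a Hecke character of `K` of infinity type `(k+j, −j)`. Suppose also that `c` and
`d_K` are odd, and let `w_K` denote the number of roots of unity in `K`. Then `C(f,χ,c)·L(f,χ⁻¹,0) =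
|∑ …|²`, where … the constant `C(f,χ,c)` is given by **`C(f,χ,c) = (1/4)·π^{k+2j−1} Γ(j+1)Γ(k+j) w_K
|d_K|^{1/2}·c·vol(𝒪_c)^{−ℓ}·2^{#S_f}·∏_{q|c}(q − ε_K(q))/(q − 1)`**", with `ℓ = k+2j` (p. 34), `S_f =
S(f) := {q : q ∣ (N, d_K), q ∤ N_{ε_f}}` (p. 37) and `vol(𝒪_c) = c·√|d_K|/2` the covolume of `𝒪_c ⊂ ℂ`
(p. 56, after (4.7.1): "`|Λ_τ|²ℑ(τ) = vol(𝒪_c)`", `𝒪_c = Λ_τ(ℤτ + ℤ)`). (p. 57) "it will be convenient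
to set **`χ_j := χN^j`** for the associated Hecke character of infinity type `(k+2j, 0)`"; (p. 58)
"(5.1.6) `(𝔟, Nc) = 1`, `𝔟𝔑 = (b_N)`", Lemma 5.2 ("`f^ρ(w_N(E,t,ω)) = w_f f(E,t,ω)`", `|w_f| = 1`),
"we define a complex scalar of norm one by the rule: **(5.1.11) `w(f,χ) := w_f·ε_f(N𝔟)⁻¹ χ_j(𝔟)
(−N)^{k/2+j} b_N^{−k−2j}`**", Lemma 5.3 ("(1) It depends only on `f` and `χ` and not on the choice of
pair `(𝔟, b_N)` satisfying (5.1.6)"). **Theorem 5.5** (p. 60): "`L_alg(f,χ⁻¹,0) := w(f,χ)⁻¹ C(f,χ,c)·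
L(f,χ⁻¹,0)/Ω^{2(k+2j)}` belongs to `F`." §5.2 (p. 61), THE TOPOLOGY: "Let `𝔸′^×_{K,f}` denote the
subgroup of `𝔸^×_{K,f}` of idèles which are prime to `p` … We equip `Σ^{(2)}_cc(𝔑)` with the topology
induced by the compact open topology on this function space, i.e., the topology of uniform
convergence on `𝔸′^×_{K,f}` relative to the `p`-adic topology on `𝒪_{F,𝔭_F}`. Let `Σ̂_cc(𝔑)` be the
completion of `Σ^{(2)}_cc(𝔑)` relative to this topology." "(5.2.2) `ω₀ = Ω_p·ω_can`", "**(5.2.3)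
`L_p(f,χ) := Ω_p^{2(k+2j)}(1 − χ⁻¹(𝔭̄)a_p + χ⁻²(𝔭̄)ε_f(p)p^{k−1})² L_alg(f,χ⁻¹,0)` (5.2.4) `=
Ω_p^{2(k+2j)}(1 − α_pχ⁻¹(𝔭̄))²(1 − β_pχ⁻¹(𝔭̄))² L_alg(f,χ⁻¹,0)`**", Rem. 5.8 ("Replacing `ι` by a
`ℤ_p^×`-multiple `aι` has the effect of multiplying `L_p(f,χ)` by `a^{2(k+2j)}`"), Thm. 5.9, **Prop.
5.10** ("The function `χ ↦ L_p(f,χ)` extends to a continuous function on `Σ̂_cc(𝔑)`").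

### The specialisation typed below (LIT-DOSSIER §40 (E), certified at the page in §40 (H))

`k = 2`, `c = 1`, `ε_f = 𝟙` (`f` on `Γ₀`), cas-split's prime-to-`p` level `N₀ = N/p` with its cyclic
ideal `𝔑` of norm `N₀`, `χ` of infinity type `(2+j, −j)`, `j ≥ 0`. DICTIONARY TO THE TREE (reading
(R1), certified by bsd-eis-lit g17 at the page, LIT-DOSSIER §40 (E)/(H)): such a `χ` is `φ·𝐍_K` with
`𝐍_K` the norm character (infinity type `(1,1)`, `𝐍_K(𝔞) = N𝔞` on ideals) and `φ := χ𝐍_K⁻¹` of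
infinity type `(1+j, −1−j) = (n, −n)`, **`n = j+1 ≥ 1`**, `ℓ = 2n`, `2(k+2j) = 4n`; `χ` unramified (of
finite type `(1, 𝔑, 𝟙)`: `χ|_{𝒪̂_K^×} = 1`) iff `φ` is unramified at every finite place, and every such
`φ` gives a member of `Σ^{(2)}_cc(𝔑)` (central critical: `ℓ₁+ℓ₂ = 2 = k`, `ε_χ = 𝟙 = ε_f`; the
auxiliary local-sign condition is automatic as `S(f) = ∅` under the Heegner hypothesis) — the tree's
`HeckeCharacter.HasInfinityType (fun _ ↦ n) (fun _ ↦ −n)` in the orientation fixed by the A-registry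
facts `castella2018_exists_isBDPLFunction` / `hsieh2014_exists_anticyclotomicPAdicLFunction` (module
docstring of `BDPAnticyclotomicPAdicLFunction.lean`); (R1a) `L(f,χ⁻¹,0) = L(f,φ⁻¹𝐍_K⁻¹,0) =
L(f,φ⁻¹,1) = L(f/K,φ,1)` is the CENTRAL value `rankinSelbergValueHecke f φ 1` with NO residual
constant (LIT-DOSSIER §40 (H′): BDP p. 34 vs the tree's Euler product, factor by factor); `χ⁻¹(𝔭̄) =
χ(𝔭)p^{−k} = φ(𝔭)·N𝔭·p⁻² = φ(𝔭)p⁻¹` by the identity printed in the proof of Thm. 2.11; `χ_j(𝔟) =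
χ(𝔟)N𝔟^j = φ(𝔟)·N𝔟^{1+j} = φ(𝔟)·N𝔟^n`; `(−N₀)^{k/2+j} = (−N₀)^n`, `b_N^{−k−2j} = b_N^{−2n}`. So,
with `vol(𝒪_K) = |d_K|^{1/2}/2`:
  `C(f,χ,1) = (1/4)·π^{2n−1}·Γ(n)Γ(n+1)·w_K·|d_K|^{1/2}·(|d_K|^{1/2}/2)^{−2n}·2^{#S(f)}`,
  `w(f,χ) = w_f·φ(𝔟)N𝔟^n·(−N₀)^n·b_N^{−2n}`,  `L_alg(f,χ⁻¹,0) = w(f,χ)⁻¹C(f,χ,1)·L(f/K,φ,1)/Ω^{4n}`,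
  `L_p(f,χ) = Ω_p^{4n}·(1 − a_p(f)p⁻¹φ(𝔭))²·L_alg(f,χ⁻¹,0)` (read in `ℂ_p` through `ι⁻¹`).
The topology of `Σ̂_cc(𝔑)` read on Galois avatars (reading (R-top), the avatar dictionary of the tree's
`IsPAdicAvatarOf` [Serre 1968, Ch. II §2.7; Weil 1956]): for `χ_k = φ_k𝐍_K`, `χ_k → 𝐍_K` uniformly on
`𝔸′^×_{K,f}` iff `ι_p∘φ_k → 1` uniformly on prime-to-`p` finite idèles; the `p`-adic avatar
`φ̂_k : 𝔸_K^×/K^× → ℂ_p^×` restricts to `ι_p∘φ_k` there and equals `r_k ∘ rec_K` for the Galois avatar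
`r_k`; hence UNIFORM CONVERGENCE `r_k → 1` ON `Γ_K` implies `χ_k → 𝐍_K` in `Σ̂_cc(𝔑)` — the fact below
asks the former, so its continuity clause is IMPLIED BY Prop. 5.10 / Thm. 2.10 (weaker than print).
What is NOT typed: `w_f` is Lemma 5.2's scalar of norm one in (4.1.4) `w_N(f) = w_f f^ρ` — for the
newform of an elliptic curve over `ℚ` (`f^ρ = ∑ ā_n qⁿ = f`, `ε_f = 𝟙`) it is the eigenvalue of the
Atkin–Lehner INVOLUTION `w_N` on `S₂(Γ₀(N))`, so `w_f = ±1` (reading (R-w), Atkin–Lehner 1970 §2 /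
Diamond–Shurman §5.6; this is the one place where a `p`-adic UNIT property of a BDP constant is used
that the norm-one sentence alone does not print) — bound here as `w_f ∈ {1, −1}`; `Ω`, `Ω_p` are the SPECIFIC periods
(5.1.15)/(5.2.2) of `(A₀, ω₀)` — bound here existentially (`Ω ≠ 0`, `Ω_p ≠ 0`), which only weakens
the statement; the ideal `𝔑` and the pair `(𝔟, b_N)` of (5.1.6) are universally quantified (Lemma
5.3 (1): `w(f,χ)` does not depend on the pair). Nothing is asserted below `p = 5`, at `p² ∣ N`, for
`c > 1`, or about `Λ_{R₀}`-membership of `L_𝔭(f)` (which at `p ∣ N` is [Cas20]/§3 under irreducibility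
— NOT used here). Datum conventions = those of the sister facts `hsieh2014_exists_anticyclotomicPAdicLFunction`
(the prime `𝔭 ∋ p` singled out by the embedding datum `ι`) and
`Castella2018.thm32_exists_isBDPLFunction_valueAtOne` (the Heegner point read through `w.embedding`, the
logarithm along any `e : K → ℚ_p` inducing `𝔭`, the parametrisation datum `Dt` with `p ∤ Dt.c`, `Odd d_K`
as in BDP Thm. 4.6 / Assumption 5.12 (3), the value "up to a `p`-adic unit").

## References

* [Castella2018Exceptional] F. Castella, JIMJ 17 (2018) 207–240, Thm. 2.10, Thm. 2.11, Prop. 2.7,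
  §1.4, §2.5–2.6 (arXiv:1507.04260 pp. 6–7, 11–14).
* [BertoliniDarmonPrasanna2013] Duke Math. J. 162 (2013) 1033–1148, (4.1.5), Thm. 4.6, §5.1 (χ_j,
  (5.1.6), (5.1.11), Lemma 5.3, Thm. 5.5, Rem. 5.6), §5.2 (topology of `Σ̂`, (5.2.3)–(5.2.4), Rem. 5.8,
  Thm. 5.9, Prop. 5.10).
* [Castella2018] F. Castella, Camb. J. Math. 6 (2018), Thm. 3.2 with (3.2)–(3.3) (arXiv:1704.06608 p. 9).
* [Nekovar1995] J. Nekovář, Math. Ann. 302 (1995), §3.4 (characters on ideals prime to the conductor,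
  extended by zero).
* [SerreAbelianLadic1968] J.-P. Serre, *Abelian ℓ-adic representations*, Ch. II §2.7 (the avatar).
-/

noncomputable section

open scoped Classical MatrixGroups ModularForm Topology
open Filter CongruenceSubgroup NumberField IsDedekindDomain Field WeierstrassCurve
open Literature.NumberTheory.EllipticCurves.ModularForms
open Literature.NumberTheory.GaloisRepresentations

namespace Literature.NumberTheory.EllipticCurves.Castella2018Exceptional

open Literature.NumberTheory.EllipticCurves.Castella2018
open Literature.NumberTheory.EllipticCurves.BertoliniDarmonPrasanna2013

universe u

/-! ### The named fact -/

section Fact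

/-- **Castella, JIMJ 17 (2018), Theorem 2.10 ∧ Theorem 2.11 at weight `2`, conductor `c = 1` (with
Prop. 2.7 and Castella CJM 18 (3.2)–(3.3)), in BDP 2013's display** — the BDP `p`-adic `L`-function of
the `p`-NEW newform of an elliptic curve as a CONTINUOUS function on `Σ̂_cc(𝔑)` carrying the display
(5.2.3)–(5.2.4) with `L_alg` of Thm. 5.5 (constants `C(f,χ,1)` of Thm. 4.6 and `w(f,χ)` of (5.1.11)),
and its value at `𝐍_K`. Data: `p ≥ 5` (as printed, §1.4), `W/ℚ` globally minimal of conductor `N` with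
`p ∣ N`, `p² ∤ N` (so `N₀ := N/p` is prime to `p` and the newform `Dt.f` of the parametrisation datum is
`p`-new on `Γ₀(N₀p)`, `a_p(f) = a_p(E) = ±1` — NO hypothesis on the residual image, NO square-freeness),
`K` imaginary quadratic of ODD discriminant (Thm. 4.6) with `p = 𝔭𝔭̄` split and the classical Heegner
hypothesis for `N` (hence for `N₀`), `𝔭 ∋ p` the prime singled out by the embedding datum `ι : ℚ̄_p ≃ ℂ`
(compatibility clause as in `hsieh2014_exists_anticyclotomicPAdicLFunction`), a cyclic ideal `𝔑` of norm
`N₀` (`𝓞 K ⧸ 𝔑 ≃ ℤ/N₀`), an auxiliary pair `(𝔟, b_N)` with `𝔟 ≠ 0` prime to `N` and `𝔟𝔑 = (b_N)`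
((5.1.6); Lemma 5.3 (1): `w(f,χ)` does not depend on it), a parametrisation datum `Dt` with `p ∤ Dt.c`
(CJM 18 (3.2)), a Heegner datum `H` with its point `P ∈ E(K)` read through `w.embedding`, and any
`e : K → ℚ_p` inducing `𝔭` for the logarithm. CONCLUSION: there are `w_f ∈ {1, −1}` (Lemma 5.2),
periods `Ω ≠ 0` ((5.1.15)), `Ω_p ≠ 0` ((5.2.2)) and `u ∈ ℂ_p` with `‖u‖ = 1` such that for EVERY
sequence `(φ_k, n_k, r_k)` — `φ_k` unramified at every finite place, of infinity type `(n_k, −n_k)`,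
`n_k ≥ 1` (so `χ_k := φ_k𝐍_K ∈ Σ^{(2)}_cc(𝔑)`, `j_k = n_k − 1 ≥ 0`), `r_k` a `p`-adic avatar of `φ_k` —
with `r_k → 1` UNIFORMLY on `Γ_K` (so `χ_k → 𝐍_K` in `Σ̂_cc(𝔑)`), the BDP values `L_p(f,χ_k)` (`bdpLp`,
`S(f) = {q : q ∣ (N₀, d_K)}`, `b_N` read in `ℂ` through `w.embedding`) tend to `(u·(1 − a_p p⁻¹)·
log_{ω_E} P)²` (`a_p = W.LFunction p`, `log_{ω_E} = padicLogOmega W p e`). PRINT: Thm. 2.10 (= BDP Thm.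
5.9 / Prop. 5.10 / (5.2.4) with `β_p = 0`) gives `L_p(f,χ_k) = L_𝔭(f)(χ_k)²` and the continuity of
`L_𝔭(f)` on `Σ̂`, hence the convergence to `L_𝔭(f)(𝐍_K)²`; Thm. 2.11 at `(2,0,0)`, `χ = 𝐍_K`, with
Prop. 2.7 and CJM 18 (3.2)–(3.3) gives `L_𝔭(f)(𝐍_K) = (1 − a_p p⁻¹)·log_{ω_E} P_K` up to a `p`-adic
unit; READINGS (module docstring, LIT-DOSSIER §40 (H)/(H′)): (R1) `Σ^{(2)}_cc(𝔑) ∋ χ = φ·𝐍_K`,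
`L(f,χ⁻¹,0) = L(f/K,φ,1)`, `χ⁻¹(𝔭̄) = φ(𝔭)p⁻¹`, `χ_j(𝔟) = φ(𝔟)N𝔟^n`, in the tree's orientation of
the infinity type; (R-top) uniform convergence of Galois avatars implies convergence in `Σ̂_cc(𝔑)`;
(R-w) `w_f = ±1` (Atkin–Lehner eigenvalue of the rational newform, `ε_f = 𝟙`); (R3) `ω_f ↦ ω_E` via
(3.2), absorbed in `u`. The weakening `∃ Ω, Ω_p` (instead of the specific periods) is recorded above. Nothing is asserted below `p = 5`, at `p² ∣ N`, for
`c > 1`, or about `Λ_{R₀}`-membership.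
[cite: Castella2018Exceptional, Thm. 2.10 and Thm. 2.11 with Prop. 2.7 (arXiv:1507.04260 pp. 13–14)]
[cite: BertoliniDarmonPrasanna2013, Thm. 4.6, (5.1.6), (5.1.11), Lemma 5.3, Thm. 5.5, §5.2 ((5.2.3)–(5.2.4), topology of Σ̂, Rem. 5.8, Thm. 5.9, Prop. 5.10)]
[cite: Castella2018, Thm. 3.2 with (3.2)–(3.3) (arXiv:1704.06608 p. 9)]
[cite: AtkinLehner1970, §2 (w_N an involution on Γ₀(N); reading (R-w))] -/
def thm210_thm211_bdpDisplay_pNew : Prop :=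
  ∀ {p : ℕ} [Fact p.Prime] (ι : PadicAlgCl p ≃+* ℂ) (W : WeierstrassCurve ℚ) [W.IsElliptic]
    [W.IsGloballyMinimal] (K : Type) [Field K] [NumberField K] (𝔭 : HeightOneSpectrum (𝓞 K))
    {N : ℕ} [NeZero N] (Dt : ModularParametrizationData W N) (H : HeegnerDatum N (NumberField.discr K))
    (w : InfinitePlace K) (e : K →+* ℚ_[p]) (P : (W.baseChange K).toAffine.Point)
    (𝔑 𝔟 : Ideal (𝓞 K)) (bN : 𝓞 K),
    5 ≤ p → W.conductorNorm ℤ = N → p ∣ N → ¬ p ^ 2 ∣ N →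
    IsImaginaryQuadratic K → Odd (NumberField.discr K) →
    ((Ideal.span {(p : ℤ)}).primesOver (𝓞 K)).ncard = 2 →
    ((p : ℕ) : 𝓞 K) ∈ 𝔭.asIdeal →
    (∀ (w' : InfinitePlace K) (k : 𝓞 K),
      k ∈ 𝔭.asIdeal ↔ ‖ι.symm (w'.embedding (k : K))‖ < 1) →
    SatisfiesHeegnerHypothesis N K →
    Nonempty (𝓞 K ⧸ 𝔑 ≃+* ZMod (N / p)) →
    𝔟 ≠ ⊥ → IsCoprime 𝔟 (Ideal.span {((N : ℕ) : 𝓞 K)}) → 𝔟 * 𝔑 = Ideal.span {bN} →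
    ¬ (p : ℤ) ∣ Dt.c →
    WeierstrassCurve.Affine.Point.map w.embedding.toRatAlgHom P = heegnerPointComplex Dt H →
    (∀ k : 𝓞 K, k ∈ 𝔭.asIdeal ↔ ‖e (k : K)‖ < 1) →
    ∃ (wf Ω : ℂ) (Ωp u : ℂ_[p]), (wf = 1 ∨ wf = -1) ∧ Ω ≠ 0 ∧ Ωp ≠ 0 ∧ ‖u‖ = 1 ∧
      ∀ (φ : ℕ → HeckeCharacter K) (n : ℕ → ℕ) (r : ℕ → FramedGaloisRep K (PadicAlgCl p) 1),
        (∀ k, 0 < n k) → (∀ k (v : HeightOneSpectrum (𝓞 K)), (φ k).IsUnramifiedAt v) →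
        (∀ k, (φ k).HasInfinityType (fun _ ↦ (n k : ℤ)) (fun _ ↦ -(n k : ℤ))) →
        (∀ k, IsPAdicAvatarOf ι (φ k) (r k)) →
        (∀ ε : ℝ, 0 < ε → ∀ᶠ k in atTop, ∀ σ : absoluteGaloisGroup K, ‖avatarValueAt (r k) σ - 1‖ < ε) →
        Tendsto (fun k ↦ bdpLp p ι Dt.f 𝔭 ((N / p).gcd (NumberField.discr K).natAbs).primeFactors.card
            wf 𝔟 (N / p) (w.embedding ((bN : K))) Ω Ωp (φ k) (n k)) atTop
          (𝓝 ((u * algebraMap ℚ_[p] ℂ_[p] (((1 : ℚ_[p]) - ((W.LFunction p : ℤ) : ℚ_[p]) *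
            (p : ℚ_[p])⁻¹) * padicLogOmega W p e P)) ^ 2))

end Fact

end Literature.NumberTheory.EllipticCurves.Castella2018Exceptional

end
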